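import Summits.SmoothPoincare4.SmoothPoincare4.Theorems.ConvexBisectionAcyclicBisectionExistsPicardLefschetzVariation
import HarnessLib

/-!
# Picard–Lefschetz on shadows, IV: the homology shadow of a page-Dehn-twisted loop
(wave 2, brick N1a = (M3c) of stub `stub_modelsOnFibred_of_reach` = NF4
`Literature.Topology.FourManifolds.LefschetzBase.modelsOnFibred_of_reach`, line `modp-braid-orbits`,
crux `ConvexBisection.AcyclicBisectionExists`, item stmt-SmoothPoincare4-10508; registered sub-goal
**`helper_shadow_pageDehnTwist`**; file 4 of the Picard–Lefschetz bricks, sequel of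
`…PicardLefschetzVariation.lean`)

**Theorem (`shadow_pageDehnTwist_eq`, homological Picard–Lefschetz in a page of the Lefschetz
base).**  Let `τ : Base g → Base g` be continuous and, on the page `page g c`, the shear
`τ (φ (u, r)) = φ (u ± β r, r)` of an annulus chart `φ` around the page curve `a` (`+` for
`s = true`, `−` for `s = false`; `β = 0` below `r = −1/2`, `β = 1` above `r = 1/2`) and the identity
off the open annulus.  Then for every loop `K` in that page

  `shadow (τ ∘ K) = shadow K + (sgn s · crossingNumber φ K) • shadow a`,

where `crossingNumber φ K ∈ ℤ` (file 2) is the winding number of the transverse coordinate of the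
chart along `K` — the signed count of passages of `K` across the annulus from `r < 0` to `r > 0`.
Proof (files 2–4): cut the unit-period loop `L` of `K` into `M` pieces each inside the open
annulus `A` or off the closed collar (Lebesgue number of the cover `L⁻¹ A ∪ L⁻¹ (collar)ᶜ`,
`isOpen_preimage_annulus`, `isCompact_collar`); `h(τ ∘ L) − h(L) = Σᵢ [zᵢ]` for the piece cycles
`zᵢ = ⟨τ ∘ Lᵢ⟩ − ⟨Lᵢ⟩ − κ_{qᵢ₊₁} + κ_{qᵢ}` (subdivision is a boundary, the correction chains
telescope); a piece inside `A` contributes `0` (`exists_d_eq_piece_of_annulus`), a piece off the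
collar contributes `(outerInd qᵢ − outerInd qᵢ₊₁) · sgn s · shadow a` (`shadowMap_corrChain`); and
the same subdivision computes `2πi · crossingNumber = Σ_{A-pieces} 2πi (χ(hᵢ₊₁) − χ(hᵢ))`
(`log_sub_log_of_annulus`, `log_sub_log_of_not_mem_collar`) `= 2πi Σ_{other pieces} (outerInd qᵢ −
outerInd qᵢ₊₁)`, since `Σᵢ (χ(hᵢ₊₁) − χ(hᵢ)) = 0` around the loop and `outerInd = χ ∘ height` off the collar.

**Relation to node N1a.**  The node asserts `shadow (τ ∘ K) = transvection (stdSymp ℤ g)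
(shadow a, s) (shadow K) = shadow K + sgn s · stdSymp (shadow a) (shadow K) · shadow a`; by
`transvection_apply` it follows from the present theorem and the identification
`crossingNumber φ K = stdSymp ℤ g (shadow g a ha) (shadow g K hK)` for charts positively oriented
by the complex orientation of the page (hypothesis `hφo` of the node, unused here) — the
"intersection form of the page in the chain basis is `stdSymp`" item (convention (c) of
`LefschetzBasePages.lean`), not proved in this file.  AUDIT of the sign pairing `s ↔ ±β`: with
`(∂ᵤφ, ∂ᵣφ)` complex-positive, the shear `u ↦ u + β r` (`s = true`) is the right-handed
(right-veering) twist — the monodromy of a positive (holomorphic) node — and acts by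
`x ↦ x + (a · x) a` with `a · x = crossingNumber`, matching `transvection … (a, true)`; so the
node's pairing is the correct one.

Everything is proved; no named facts, no `sorry`.  References: B. Farb, D. Margalit, *A primer on
mapping class groups* (2012), Prop. 6.3 [FarbMargalit2012]; R. E. Gompf, A. I. Stipsicz, *4-Manifolds
and Kirby Calculus* (1999), §8.2 [GompfStipsicz1999]; A. Hatcher, *Algebraic Topology* (2002), Thm. 2A.1.
-/

noncomputable section

set_option linter.dupNamespace false

open scoped Manifold ContDiff Topology Real
open Set Function Metric Filter
open Literature.Topology.FourManifolds Literature.Topology.FourManifolds.LefschetzBase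
  Literature.AlgebraicTopology.SingularHomology Literature.AlgebraicTopology.FundamentalGroup.PathSegment
  Literature.GroupTheory.CombinatorialGroupTheory.SignedHurwitz

namespace Summit.SmoothPoincare4.SmoothPoincare4.Theorems.AcyclicBisectionExists.ModpBraidOrbits

open SingularSimplex singularChainComplex

variable {g : ℕ} {c : ℂ} {φ : ℝ × ℝ → Base g} {τ : Base g → Base g} {s : Bool} {β : ℝ → ℝ}
  {a K : sphere (0 : EuclideanSpace ℝ (Fin 2)) 1 → Base g}

/-! ## §1 Book-keeping: classes of sums, the unit-period loop, the subdivision -/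

/-- The class of a sum of `1`-cycles is the sum of the classes. [folklore] -/
theorem homologyCls_finset_sum {X : Type} [TopologicalSpace X] (S : Finset ℕ)
    (z : ℕ → (singularChainComplex ℤ ℤ X).X 1)
    (hz : ∀ i, (singularChainComplex ℤ ℤ X).d 1 ((ComplexShape.down ℕ).next 1) (z i) = 0)
    (h : (singularChainComplex ℤ ℤ X).d 1 ((ComplexShape.down ℕ).next 1) (∑ i ∈ S, z i) = 0) :
    homologyCls (∑ i ∈ S, z i) h = ∑ i ∈ S, homologyCls (z i) (hz i) := by
  classical
  induction S using Finset.induction_on with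
  | empty =>
    rw [homologyCls_congr Finset.sum_empty h (by rw [map_zero]), homologyCls_zero, Finset.sum_empty]
  | insert j S hj ih =>
    have h' : (singularChainComplex ℤ ℤ X).d 1 ((ComplexShape.down ℕ).next 1) (∑ i ∈ S, z i) = 0 := by
      rw [map_sum]; exact Finset.sum_eq_zero fun i _ => hz i
    have h'' : (singularChainComplex ℤ ℤ X).d 1 ((ComplexShape.down ℕ).next 1) (z j + ∑ i ∈ S, z i) = 0 := by
      rw [map_add, hz j, h', add_zero]
    rw [homologyCls_congr (Finset.sum_insert hj) h h'', homologyCls_add _ _ (hz j) h' h'', ih h',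
      Finset.sum_insert hj]

/-- The extension of the unit-period loop of `K` runs in `K`'s image. [folklore] -/
theorem loopPath_extend (hK : Continuous K) (t : ℝ) :
    (loopPath K hK).extend t = K (circlePt (projIcc 0 1 zero_le_one t)) := rfl

/-- On `[0, 1]` the extension of the unit-period loop is `t ↦ K (e^{2πit})`. [folklore] -/
theorem loopPath_extend_of_mem (hK : Continuous K) {t : ℝ} (ht : t ∈ Icc (0 : ℝ) 1) :
    (loopPath K hK).extend t = K (circlePt t) := by
  rw [Path.extend_apply _ ht]; rfl

/-- **The subdivision**: the unit-period loop of a page curve cuts into `M ≥ 1` equal pieces each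
inside the open annulus or off the closed collar (Lebesgue number). [folklore] -/
theorem exists_subdivision (hc : ‖c‖ = 1) (hφc : Continuous φ)
    (hφ1 : ∀ u r, φ (u + 1, r) = φ (u, r)) (hφp : ∀ p, φ p ∈ page g c)
    (hφi : InjOn φ (Ico (0 : ℝ) 1 ×ˢ Ioo (-1 : ℝ) 1)) (hK : Continuous K)
    (hKc : ∀ θ, K θ ∈ page g c) :
    ∃ M : ℕ, M ≠ 0 ∧ ∀ i : ℕ, i < M →
      (∀ t ∈ Icc ((i : ℝ) / M) (((i : ℝ) + 1) / M), K (circlePt t) ∈ φ '' (univ ×ˢ Ioo (-1 : ℝ) 1)) ∨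
      (∀ t ∈ Icc ((i : ℝ) / M) (((i : ℝ) + 1) / M),
        K (circlePt t) ∉ φ '' (univ ×ˢ Icc (-(1 / 2) : ℝ) (1 / 2))) := by
  have hL : Continuous fun t : ℝ => K (circlePt t) := hK.comp continuous_circlePt
  let cov : Bool → Set ℝ := fun b => cond b
    ((fun t : ℝ => K (circlePt t)) ⁻¹' (φ '' (univ ×ˢ Ioo (-1 : ℝ) 1)))
    ((fun t : ℝ => K (circlePt t)) ⁻¹' (φ '' (univ ×ˢ Icc (-(1 / 2) : ℝ) (1 / 2)))ᶜ)
  have hopen : ∀ b, IsOpen (cov b) := by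
    rintro (_ | _)
    · exact ((isCompact_collar hφc hφ1).isClosed.preimage hL).isOpen_compl
    · exact isOpen_preimage_annulus hc hφc hφ1 hφp hφi hL fun t => hKc _
  have hcover : Icc (0 : ℝ) 1 ⊆ ⋃ b, cov b := by
    intro t _
    by_cases h : K (circlePt t) ∈ φ '' (univ ×ˢ Ioo (-1 : ℝ) 1)
    · exact mem_iUnion.2 ⟨true, h⟩
    · refine mem_iUnion.2 ⟨false, fun h' => h ?_⟩
      exact image_mono (prod_mono Subset.rfl (Icc_subset_Ioo (by norm_num) (by norm_num))) h'
  obtain ⟨δ, hδ, hδU⟩ := lebesgue_number_lemma_of_metric isCompact_Icc hopen hcover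
  obtain ⟨N, hN⟩ := exists_nat_one_div_lt hδ
  refine ⟨N + 1, Nat.succ_ne_zero N, fun i hi => ?_⟩
  have hM : (0 : ℝ) < (N + 1 : ℕ) := by positivity
  have hsI : (i : ℝ) / (N + 1 : ℕ) ∈ Icc (0 : ℝ) 1 :=
    ⟨by positivity, by rw [div_le_one hM]; exact_mod_cast hi.le⟩
  obtain ⟨b, hb⟩ := hδU _ hsI
  have hsub : Icc ((i : ℝ) / (N + 1 : ℕ)) (((i : ℝ) + 1) / (N + 1 : ℕ)) ⊆ ball ((i : ℝ) / (N + 1 : ℕ)) δ := by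
    intro t ht
    rw [mem_ball, Real.dist_eq, abs_lt]
    have h1 : ((i : ℝ) + 1) / (N + 1 : ℕ) - (i : ℝ) / (N + 1 : ℕ) = 1 / (N + 1 : ℕ) := by
      field_simp; ring
    have h2 : (1 : ℝ) / (N + 1 : ℕ) < δ := by exact_mod_cast hN
    constructor <;> linarith [ht.1, ht.2]
  cases b
  · exact Or.inr fun t ht => hb (hsub ht)
  · exact Or.inl fun t ht => hb (hsub ht)

/-! ## §2 The variation as a sum over the pieces -/

/-- The `i`-th piece cycle `zᵢ = ⟨τ ∘ L[i/M, (i+1)/M]⟩ − ⟨L[i/M, (i+1)/M]⟩ − κ_{qᵢ₊₁} + κ_{qᵢ}` of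
the unit-period loop `L` of `K`. [folklore] -/
def pieceCycle (hφc : Continuous φ) (hτ : Continuous τ) (s : Bool) (β : ℝ → ℝ) (hK : Continuous K)
    (M i : ℕ) : (singularChainComplex ℤ ℤ (Base g)).X 1 :=
  single (R := ℤ) (ofPath (segment ((loopPath K hK).map hτ) ((i : ℝ) / M) (((i : ℝ) + 1) / M))) 1 -
    single (R := ℤ) (ofPath (segment (loopPath K hK) ((i : ℝ) / M) (((i : ℝ) + 1) / M))) 1 -
    corrChain hφc s β ((loopPath K hK).extend (((i : ℝ) + 1) / M)) +
    corrChain hφc s β ((loopPath K hK).extend ((i : ℝ) / M))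

/-- The piece cycles are cycles. [folklore] -/
theorem pieceCycle_cycle (hφc : Continuous φ) (hτ : Continuous τ)
    (hτon : ∀ u r, r ∈ Ioo (-1 : ℝ) 1 → τ (φ (u, r)) = φ (u + (if s then β r else -β r), r))
    (hτoff : ∀ p ∈ page g c, p ∉ φ '' (univ ×ˢ Ioo (-1 : ℝ) 1) → τ p = p)
    (hK : Continuous K) (hKc : ∀ θ, K θ ∈ page g c) (M i : ℕ) :
    (singularChainComplex ℤ ℤ (Base g)).d 1 ((ComplexShape.down ℕ).next 1)
      (pieceCycle hφc hτ s β hK M i) = 0 := by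
  have hq : ∀ t, (loopPath K hK).extend t ∈ page g c := fun t => by
    rw [loopPath_extend]; exact hKc _
  rw [d_next_eq_zero_iff (ChainComplex.next_nat_succ 0), pieceCycle, map_add, map_sub, map_sub,
    d_single_ofPath, d_single_ofPath, d_corrChain hφc hτon hτoff (hq _),
    d_corrChain hφc hτon hτoff (hq _), map_extend, map_extend]
  abel

/-- **The variation is the sum of the piece classes**:
`shadow (τ ∘ K) − shadow K = Σ_{i<M} shadowMap [zᵢ]`. [cite: HatcherAT2002, Thm. 2A.1] -/
theorem shadow_sub_eq_sum (hφc : Continuous φ) (hτ : Continuous τ)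
    (hτon : ∀ u r, r ∈ Ioo (-1 : ℝ) 1 → τ (φ (u, r)) = φ (u + (if s then β r else -β r), r))
    (hτoff : ∀ p ∈ page g c, p ∉ φ '' (univ ×ˢ Ioo (-1 : ℝ) 1) → τ p = p)
    (hK : Continuous K) (hKc : ∀ θ, K θ ∈ page g c) {M : ℕ} (hM : M ≠ 0) :
    shadow g (τ ∘ K) (hτ.comp hK) - shadow g K hK = ∑ i ∈ Finset.range M,
      shadowMap g (homologyCls (pieceCycle hφc hτ s β hK M i)
        (pieceCycle_cycle hφc hτ hτon hτoff hK hKc M i)) := by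
  have hLτ : loopPath (τ ∘ K) (hτ.comp hK) = (loopPath K hK).map hτ := by ext t; rfl
  obtain ⟨w, hw⟩ := exists_d_eq_sub_sum_segments (loopPath K hK) hM
  obtain ⟨w', hw'⟩ := exists_d_eq_sub_sum_segments ((loopPath K hK).map hτ) hM
  -- the correction chains telescope
  have htel : ∑ i ∈ Finset.range M, (corrChain hφc s β ((loopPath K hK).extend (((i : ℝ) + 1) / M)) -
      corrChain hφc s β ((loopPath K hK).extend ((i : ℝ) / M))) = 0 := by
    have h := Finset.sum_range_sub
      (fun i : ℕ => corrChain hφc s β ((loopPath K hK).extend ((i : ℝ) / M))) M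
    simp only [Nat.cast_succ] at h
    rw [h, div_self (Nat.cast_ne_zero.2 hM), Nat.cast_zero, zero_div, Path.extend_one,
      Path.extend_zero, sub_self]
  have hsum : ∑ i ∈ Finset.range M, pieceCycle hφc hτ s β hK M i =
      (single (R := ℤ) (ofPath ((loopPath K hK).map hτ)) 1 - single (R := ℤ) (ofPath (loopPath K hK)) 1) -
        (singularChainComplex ℤ ℤ (Base g)).d 2 1 (w' - w) := by
    have e : ∑ i ∈ Finset.range M, pieceCycle hφc hτ s β hK M i =
        ∑ i ∈ Finset.range M, single (R := ℤ) (ofPath (segment ((loopPath K hK).map hτ)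
          ((i : ℝ) / M) (((i : ℝ) + 1) / M))) 1 -
        ∑ i ∈ Finset.range M, single (R := ℤ) (ofPath (segment (loopPath K hK)
          ((i : ℝ) / M) (((i : ℝ) + 1) / M))) 1 -
        ∑ i ∈ Finset.range M, (corrChain hφc s β ((loopPath K hK).extend (((i : ℝ) + 1) / M)) -
          corrChain hφc s β ((loopPath K hK).extend ((i : ℝ) / M))) := by
      simp only [pieceCycle, Finset.sum_add_distrib, Finset.sum_sub_distrib]
      abel
    rw [e, htel, sub_zero, map_sub, hw, hw']
    abel
  have hcyc : ∀ i, (singularChainComplex ℤ ℤ (Base g)).d 1 ((ComplexShape.down ℕ).next 1)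
      (pieceCycle hφc hτ s β hK M i) = 0 := pieceCycle_cycle hφc hτ hτon hτoff hK hKc M
  have hS : (singularChainComplex ℤ ℤ (Base g)).d 1 ((ComplexShape.down ℕ).next 1)
      (∑ i ∈ Finset.range M, pieceCycle hφc hτ s β hK M i) = 0 := by
    rw [map_sum]; exact Finset.sum_eq_zero fun i _ => hcyc i
  rw [← map_sum, ← homologyCls_finset_sum _ _ hcyc hS]
  have hD : (singularChainComplex ℤ ℤ (Base g)).d 1 ((ComplexShape.down ℕ).next 1)
      (single (R := ℤ) (ofPath ((loopPath K hK).map hτ)) 1 - single (R := ℤ) (ofPath (loopPath K hK)) 1) = 0 := by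
    rw [map_sub, d_single_ofPath_loop, d_single_ofPath_loop, sub_zero]
  have hdiff : loopClass ℤ ℤ (1 : ℤ) ((loopPath K hK).map hτ) - loopClass ℤ ℤ (1 : ℤ) (loopPath K hK) =
      homologyCls (∑ i ∈ Finset.range M, pieceCycle hφc hτ s β hK M i) hS := by
    rw [loopClass, loopClass, ← homologyCls_sub _ _ _ _ hD, homologyCls_eq_homologyCls_iff,
      exists_d_prev_eq_iff (i := 2) (ChainComplex.prev ℕ 1)]
    exact ⟨w' - w, by rw [hsum]; abel⟩
  rw [← hdiff, map_sub, shadow, shadow, hLτ]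
  rfl

open Classical in
/-- **An inside piece contributes nothing; an outside piece contributes
`(outerInd qᵢ − outerInd qᵢ₊₁) · sgn s · shadow a`.** [cite: FarbMargalit2012, Prop. 6.3] -/
theorem shadowMap_pieceCycle (hc : ‖c‖ = 1) (hφc : Continuous φ)
    (hφ1 : ∀ u r, φ (u + 1, r) = φ (u, r)) (hφa : ∀ u, φ (u, 0) = a (circlePt u)) (ha : Continuous a)
    (hφp : ∀ p, φ p ∈ page g c) (hφi : InjOn φ (Ico (0 : ℝ) 1 ×ˢ Ioo (-1 : ℝ) 1))
    (hβc : Continuous β) (hβ0 : ∀ r ≤ -(1 / 2 : ℝ), β r = 0) (hβ1 : ∀ r ≥ (1 / 2 : ℝ), β r = 1)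
    (hτ : Continuous τ)
    (hτon : ∀ u r, r ∈ Ioo (-1 : ℝ) 1 → τ (φ (u, r)) = φ (u + (if s then β r else -β r), r))
    (hτoff : ∀ p ∈ page g c, p ∉ φ '' (univ ×ˢ Ioo (-1 : ℝ) 1) → τ p = p)
    (hK : Continuous K) (hKc : ∀ θ, K θ ∈ page g c) {M i : ℕ} (hiM : i < M)
    (hdes : (∀ t ∈ Icc ((i : ℝ) / M) (((i : ℝ) + 1) / M), K (circlePt t) ∈ φ '' (univ ×ˢ Ioo (-1 : ℝ) 1)) ∨
      (∀ t ∈ Icc ((i : ℝ) / M) (((i : ℝ) + 1) / M),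
        K (circlePt t) ∉ φ '' (univ ×ˢ Icc (-(1 / 2) : ℝ) (1 / 2))))
    (hz : (singularChainComplex ℤ ℤ (Base g)).d 1 ((ComplexShape.down ℕ).next 1)
      (pieceCycle hφc hτ s β hK M i) = 0) :
    shadowMap g (homologyCls (pieceCycle hφc hτ s β hK M i) hz) =
      ((if ∀ t ∈ Icc ((i : ℝ) / M) (((i : ℝ) + 1) / M), K (circlePt t) ∈ φ '' (univ ×ˢ Ioo (-1 : ℝ) 1)
        then (0 : ℤ) else
        outerInd φ (K (circlePt ((i : ℝ) / M))) - outerInd φ (K (circlePt (((i : ℝ) + 1) / M)))) *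
        (sgn s : ℤ)) • shadow g a ha := by
  classical
  have hM : (0 : ℝ) < M := by exact_mod_cast Nat.zero_lt_of_lt hiM
  have h12 : (i : ℝ) / M ≤ ((i : ℝ) + 1) / M := by gcongr; linarith
  have hI0 : ((i : ℝ) / M) ∈ Icc (0 : ℝ) 1 :=
    ⟨by positivity, by rw [div_le_one hM]; exact_mod_cast hiM.le⟩
  have hI1 : (((i : ℝ) + 1) / M) ∈ Icc (0 : ℝ) 1 :=
    ⟨by positivity, by rw [div_le_one hM]; exact_mod_cast hiM⟩
  have hIcc : Icc ((i : ℝ) / M) (((i : ℝ) + 1) / M) ⊆ Icc (0 : ℝ) 1 := Icc_subset_Icc hI0.1 hI1.2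
  have hext : ∀ t ∈ Icc ((i : ℝ) / M) (((i : ℝ) + 1) / M), (loopPath K hK).extend t = K (circlePt t) :=
    fun t ht => loopPath_extend_of_mem hK (hIcc ht)
  by_cases hA : ∀ t ∈ Icc ((i : ℝ) / M) (((i : ℝ) + 1) / M), K (circlePt t) ∈ φ '' (univ ×ˢ Ioo (-1 : ℝ) 1)
  · -- inside the annulus: a boundary
    rw [if_pos hA, zero_mul, zero_smul]
    obtain ⟨w, hw⟩ := exists_d_eq_piece_of_annulus hc hφc hφ1 hφp hφi hβc hτ hτon (loopPath K hK) h12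
      (fun t ht => by rw [hext t ht]; exact hA t ht)
    have h0 : homologyCls (pieceCycle hφc hτ s β hK M i) hz = 0 := by
      rw [homologyCls_eq_zero_iff, exists_d_prev_eq_iff (i := 2) (ChainComplex.prev ℕ 1)]
      exact ⟨w, by rw [hw, pieceCycle]⟩
    rw [h0, map_zero]
  · -- off the collar: the correction chains of the two ends
    have hB := hdes.resolve_left hA
    rw [if_neg hA]
    have hq : ∀ t, (loopPath K hK).extend t ∈ page g c := fun t => by
      rw [loopPath_extend]; exact hKc _
    have hB' : ∀ t ∈ Icc ((i : ℝ) / M) (((i : ℝ) + 1) / M),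
        (loopPath K hK).extend t ∉ φ '' (univ ×ˢ Icc (-(1 / 2) : ℝ) (1 / 2)) := fun t ht => by
      rw [hext t ht]; exact hB t ht
    have hseg := ofPath_segment_map_of_not_mem_collar hφ1 hβ0 hβ1 hτ hτon hτoff (loopPath K hK) hq
      h12 hB'
    have hz0 := corrChain_cycle hφc hφ1 hβ0 hβ1 hτon hτoff (hq ((i : ℝ) / M))
      (hB' _ (left_mem_Icc.2 h12))
    have hz1 := corrChain_cycle hφc hφ1 hβ0 hβ1 hτon hτoff (hq (((i : ℝ) + 1) / M))
      (hB' _ (right_mem_Icc.2 h12))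
    have e : pieceCycle hφc hτ s β hK M i = corrChain hφc s β ((loopPath K hK).extend ((i : ℝ) / M)) -
        corrChain hφc s β ((loopPath K hK).extend (((i : ℝ) + 1) / M)) := by
      rw [pieceCycle, hseg]; abel
    rw [homologyCls_congr e hz (by rw [map_sub, hz0, hz1, sub_zero]), homologyCls_sub _ _ hz0 hz1,
      map_sub, shadowMap_corrChain hφc hφ1 hφa ha hβ0 hβ1 (hB' _ (left_mem_Icc.2 h12)),
      shadowMap_corrChain hφc hφ1 hφa ha hβ0 hβ1 (hB' _ (right_mem_Icc.2 h12)), ← sub_smul,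
      hext _ (left_mem_Icc.2 h12), hext _ (right_mem_Icc.2 h12)]
    congr 1
    ring

/-! ## §3 The crossing number as a sum over the same pieces -/

open Classical in
/-- **`crossingNumber = Σᵢ dᵢ`** with `dᵢ = 0` for an inside piece and
`dᵢ = outerInd qᵢ − outerInd qᵢ₊₁` for an outside piece. [folklore] -/
theorem crossingNumber_eq_sum (hc : ‖c‖ = 1) (hφc : Continuous φ)
    (hφ1 : ∀ u r, φ (u + 1, r) = φ (u, r)) (hφp : ∀ p, φ p ∈ page g c)
    (hφi : InjOn φ (Ico (0 : ℝ) 1 ×ˢ Ioo (-1 : ℝ) 1)) (hK : Continuous K)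
    (hKc : ∀ θ, K θ ∈ page g c) {M : ℕ} (hM : M ≠ 0)
    (hdes : ∀ i : ℕ, i < M →
      (∀ t ∈ Icc ((i : ℝ) / M) (((i : ℝ) + 1) / M), K (circlePt t) ∈ φ '' (univ ×ˢ Ioo (-1 : ℝ) 1)) ∨
      (∀ t ∈ Icc ((i : ℝ) / M) (((i : ℝ) + 1) / M),
        K (circlePt t) ∉ φ '' (univ ×ˢ Icc (-(1 / 2) : ℝ) (1 / 2)))) :
    crossingNumber φ K = ∑ i ∈ Finset.range M,
      (if ∀ t ∈ Icc ((i : ℝ) / M) (((i : ℝ) + 1) / M), K (circlePt t) ∈ φ '' (univ ×ˢ Ioo (-1 : ℝ) 1)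
        then (0 : ℤ) else
        outerInd φ (K (circlePt ((i : ℝ) / M))) - outerInd φ (K (circlePt (((i : ℝ) + 1) / M)))) := by
  classical
  have hM0 : (0 : ℝ) < M := by exact_mod_cast Nat.pos_of_ne_zero hM
  -- a logarithm of the phase loop on `[0, 1]`
  have hf := continuous_phaseLoop hc hφc hφ1 hφp hφi hK hKc
  obtain ⟨l, hl, hle⟩ := Literature.Topology.PlaneTopology.hasLogOn_Icc (a := 0) (b := 1)
    hf.continuousOn fun t _ => Complex.exp_ne_zero _
  have h01 : phaseLoop φ K 0 = phaseLoop φ K 1 := by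
    unfold phaseLoop; rw [← circlePt_add_one 0, zero_add]
  have hwind := Literature.Topology.PlaneTopology.wind_spec hl hle h01
  -- node values of the clamped height
  obtain ⟨E, hE⟩ : ∃ E : ℕ → ℝ, ∀ i : ℕ, E i = clampStep (height φ (K (circlePt ((i : ℝ) / M)))) :=
    ⟨_, fun i => rfl⟩
  have hE' : ∀ i : ℕ, clampStep (height φ (K (circlePt (((i : ℝ) + 1) / M)))) = E (i + 1) :=
    fun i => by rw [hE, Nat.cast_succ]
  -- increments of the logarithm along the pieces
  have hinc : ∀ i ∈ Finset.range M, l (((i : ℝ) + 1) / M) - l ((i : ℝ) / M) =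
      (if ∀ t ∈ Icc ((i : ℝ) / M) (((i : ℝ) + 1) / M), K (circlePt t) ∈ φ '' (univ ×ˢ Ioo (-1 : ℝ) 1)
        then (((2 * π * (E (i + 1) - E i) : ℝ) : ℂ) * Complex.I) else 0) := by
    intro i hi
    rw [Finset.mem_range] at hi
    have h12 : (i : ℝ) / M ≤ ((i : ℝ) + 1) / M := by gcongr; linarith
    have hIcc : Icc ((i : ℝ) / M) (((i : ℝ) + 1) / M) ⊆ Icc (0 : ℝ) 1 :=
      Icc_subset_Icc (by positivity) (by rw [div_le_one hM0]; exact_mod_cast hi)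
    split_ifs with hA
    · rw [log_sub_log_of_annulus hc hφc hφ1 hφp hφi hK h12 hA (hl.mono hIcc)
        (fun t ht => hle t (hIcc ht)), hE', ← hE i]
    · exact log_sub_log_of_not_mem_collar h12 ((hdes i hi).resolve_left hA) (hl.mono hIcc)
        fun t ht => hle t (hIcc ht)
  -- the clamped heights telescope to zero around the loop
  have htel : ∑ i ∈ Finset.range M, (E (i + 1) - E i) = 0 := by
    rw [Finset.sum_range_sub, hE, hE, Nat.cast_zero, zero_div, div_self (ne_of_gt hM0),
      ← circlePt_add_one 0, zero_add, sub_self]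
  -- the logarithm telescopes to `2πi · wind`
  have hlsum : ∑ i ∈ Finset.range M, (l (((i : ℝ) + 1) / M) - l ((i : ℝ) / M)) = l 1 - l 0 := by
    have h := Finset.sum_range_sub (fun i : ℕ => l ((i : ℝ) / M)) M
    simp only [Nat.cast_succ] at h
    rw [h, div_self (ne_of_gt hM0), Nat.cast_zero, zero_div]
  -- outside pieces: `outerInd = χ ∘ height` at both ends
  have hd : ∀ i ∈ Finset.range M,
      (((if ∀ t ∈ Icc ((i : ℝ) / M) (((i : ℝ) + 1) / M), K (circlePt t) ∈ φ '' (univ ×ˢ Ioo (-1 : ℝ) 1)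
        then (0 : ℤ) else
        outerInd φ (K (circlePt ((i : ℝ) / M))) - outerInd φ (K (circlePt (((i : ℝ) + 1) / M)))) : ℤ) : ℂ) *
        (2 * π * Complex.I) =
      (if ∀ t ∈ Icc ((i : ℝ) / M) (((i : ℝ) + 1) / M), K (circlePt t) ∈ φ '' (univ ×ˢ Ioo (-1 : ℝ) 1)
        then (((2 * π * (E (i + 1) - E i) : ℝ) : ℂ) * Complex.I) else 0) -
        ((2 * π * (E (i + 1) - E i) : ℝ) : ℂ) * Complex.I := by
    intro i hi
    rw [Finset.mem_range] at hi
    split_ifs with hA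
    · simp
    · have hB := (hdes i hi).resolve_left hA
      have h12 : (i : ℝ) / M ≤ ((i : ℝ) + 1) / M := by gcongr; linarith
      have e0 : ((outerInd φ (K (circlePt ((i : ℝ) / M))) : ℤ) : ℂ) = ((E i : ℝ) : ℂ) := by
        rw [hE, ← outerInd_eq_clampStep (hB _ (left_mem_Icc.2 h12)), Complex.ofReal_intCast]
      have e1 : ((outerInd φ (K (circlePt (((i : ℝ) + 1) / M))) : ℤ) : ℂ) = ((E (i + 1) : ℝ) : ℂ) := by
        rw [← hE', ← outerInd_eq_clampStep (hB _ (right_mem_Icc.2 h12)), Complex.ofReal_intCast]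
      push_cast
      rw [e0, e1]
      ring
  have hzero : ∑ i ∈ Finset.range M, ((2 * π * (E (i + 1) - E i) : ℝ) : ℂ) * Complex.I = 0 := by
    rw [← Finset.sum_mul, ← Complex.ofReal_sum, ← Finset.mul_sum, htel, mul_zero,
      Complex.ofReal_zero, zero_mul]
  apply Literature.Topology.PlaneTopology.int_eq_of_mul_two_pi_I_eq
  rw [crossingNumber, ← hwind, ← hlsum, Finset.sum_congr rfl hinc, Int.cast_sum, Finset.sum_mul,
    Finset.sum_congr rfl hd, Finset.sum_sub_distrib, hzero, sub_zero]

/-! ## §4 The theorem -/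

/-- **Homological Picard–Lefschetz in a page of the Lefschetz base** (intermediate form of node
N1a): the shadow of a page-Dehn-twisted loop is `shadow K + (sgn s · crossingNumber φ K) • shadow a`.
[cite: FarbMargalit2012, Prop. 6.3] -/
theorem shadow_pageDehnTwist_eq (hc : ‖c‖ = 1) (hτ : Continuous τ) (ha : Continuous a)
    (hφc : Continuous φ) (hφ1 : ∀ u r, φ (u + 1, r) = φ (u, r))
    (hφa : ∀ u, φ (u, 0) = a (circlePt u)) (hφp : ∀ p, φ p ∈ page g c)
    (hφi : InjOn φ (Ico (0 : ℝ) 1 ×ˢ Ioo (-1 : ℝ) 1)) (hβc : Continuous β)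
    (hβ0 : ∀ r ≤ -(1 / 2 : ℝ), β r = 0) (hβ1 : ∀ r ≥ (1 / 2 : ℝ), β r = 1)
    (hτon : ∀ u r, r ∈ Ioo (-1 : ℝ) 1 → τ (φ (u, r)) = φ (u + (if s then β r else -β r), r))
    (hτoff : ∀ p ∈ page g c, p ∉ φ '' (univ ×ˢ Ioo (-1 : ℝ) 1) → τ p = p)
    (hK : Continuous K) (hKc : ∀ θ, K θ ∈ page g c) :
    shadow g (τ ∘ K) (hτ.comp hK) =
      shadow g K hK + ((sgn s : ℤ) * crossingNumber φ K) • shadow g a ha := by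
  obtain ⟨M, hM, hdes⟩ := exists_subdivision hc hφc hφ1 hφp hφi hK hKc
  rw [← sub_eq_iff_eq_add', shadow_sub_eq_sum hφc hτ hτon hτoff hK hKc hM,
    crossingNumber_eq_sum hc hφc hφ1 hφp hφi hK hKc hM hdes, Finset.mul_sum, Finset.sum_smul]
  refine Finset.sum_congr rfl fun i hi => ?_
  rw [shadowMap_pieceCycle hc hφc hφ1 hφa ha hφp hφi hβc hβ0 hβ1 hτ hτon hτoff hK hKc
    (Finset.mem_range.1 hi) (hdes i (Finset.mem_range.1 hi)), mul_comm]

/-- **Sub-goal `helper_shadow_pageDehnTwist`** (node N1a of NF4, intermediate form): for a page Dehn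
twist given as the shear `(u, r) ↦ (u ± β r, r)` of an annulus chart around the page curve `a`,
`shadow (τ ∘ K) = shadow K + (sgn s · crossingNumber φ K) • shadow a` for every loop `K` of the page.
[cite: FarbMargalit2012, Prop. 6.3] -/
theorem helper_shadow_pageDehnTwist : ∀ (g : ℕ) (c : ℂ) (_hc : ‖c‖ = 1) (τ : Literature.Topology.FourManifolds.LefschetzBase.Base g → Literature.Topology.FourManifolds.LefschetzBase.Base g) (hτ : Continuous τ) (a : Metric.sphere (0 : EuclideanSpace ℝ (Fin 2)) 1 → Literature.Topology.FourManifolds.LefschetzBase.Base g) (ha : Continuous a) (s : Bool) (φ : ℝ × ℝ → Literature.Topology.FourManifolds.LefschetzBase.Base g) (β : ℝ → ℝ) (_hφs : ContMDiff 𝓘(ℝ, ℝ × ℝ) (𝓡∂ 4) ∞ φ) (_hφ1 : ∀ u r, φ (u + 1, r) = φ (u, r)) (_hφa : ∀ u, φ (u, 0) = a (Literature.Topology.FourManifolds.circlePt u)) (_hφp : ∀ p, φ p ∈ Literature.Topology.FourManifolds.LefschetzBase.page g c) (_hφi : Set.InjOn φ (Set.Ico (0 : ℝ) 1 ×ˢ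 Set.Ioo (-1 : ℝ) 1)) (_hφo : ∀ u r, r ∈ Set.Ioo (-1 : ℝ) 1 → 0 < inner ℝ (deriv (fun r' => (φ (u, r')).1) r) (Literature.Topology.FourManifolds.LefschetzBase.cplxJ (deriv (fun u' => (φ (u', r)).1) u))) (_hβs : ContDiff ℝ ∞ β) (_hβ0 : ∀ r ≤ -(1 / 2 : ℝ), β r = 0) (_hβ1 : ∀ r ≥ (1 / 2 : ℝ), β r = 1) (_hτon : ∀ u r, r ∈ Set.Ioo (-1 : ℝ) 1 → τ (φ (u, r)) = φ (u + (if s then β r else -β r), r)) (_hτoff : ∀ p ∈ Literature.Topology.FourManifolds.LefschetzBase.page g c, p ∉ φ '' (Set.univ ×ˢ Set.Ioo (-1 : ℝ) 1) → τ p = p) (K : Metric.sphere (0 : EuclideanSpace ℝ (Fin 2)) 1 → Literature.Topology.FourManifolds.LefschetzBase.Base g) (hK : Continuous K) (_hKc : ∀ θ, K θ ∈ Literature.Topology.FourManifolds.LefschetzBase.page g c), Literature.Topology.FourManifolds.LefschetzBase.shadow g (τ ∘ K) (hτ.comp hK) = Literature.Topology.FourManifolds.LefschetzBase.shadow g K hK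 + ((Literature.GroupTheory.CombinatorialGroupTheory.SignedHurwitz.sgn s : ℤ) * Summit.SmoothPoincare4.SmoothPoincare4.Theorems.AcyclicBisectionExists.ModpBraidOrbits.crossingNumber φ K) • Literature.Topology.FourManifolds.LefschetzBase.shadow g a ha :=
  fun _ _ hc _ hτ _ ha _ _ _ hφs hφ1 hφa hφp hφi _ hβs hβ0 hβ1 hτon hτoff _ hK hKc =>
    shadow_pageDehnTwist_eq hc hτ ha hφs.continuous hφ1 hφa hφp hφi hβs.continuous hβ0 hβ1 hτon
      hτoff hK hKc

end Summit.SmoothPoincare4.SmoothPoincare4.Theorems.AcyclicBisectionExists.ModpBraidOrbits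

end
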